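import Summits.HodgeConjecture.HodgeConjecture.Cruxes.BlochSeedDiscOne.DepthBoundA4

/-!
# CHARGE–RADIAL LAW (hsemireg-monad-1 g14) — for EVERY integer letter design on ANY height-`h` alphabet, clause 1 of (A1) alone ties the
# charge to the RADIAL functional:  `μ ≡ 2(1+i)·R_h(D)  (mod 32ℤ[i])`,  `R_h(D) = Σ_N m·∏_f (h + a_f) − Σ_P m·∏_f (h + a_f) ∈ ℤ`

line stmt-HodgeConjecture-18881 Cruxes/BlochSeedDiscOne/Lines/birth.lean 814a6a70c14e831a stub_rung_pad4_seedAt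

CENSUS-NEUTRAL.  Letter-model class arithmetic only (`DepthBoundA4`'s `Design`, `Design.T`, `Design.mu`, `Design.OnAlphabet`); nothing here is a
door statement (RuleD ∕ Hall play no role), a copy bound, a sheaf, a monad or a SEED, and NOTHING toward HC ∕ HC_CM ∕ HC_AV ∕ №4 ∕ 26512 ∕ 18881 ∕ H2
is proved.  Words by director-hodge only.  Companion of `ChargeIdealLaw.lean` (LAW 1: `μ ∈ 16(1+i)ℤ[i]`); self-contained (imports `DepthBoundA4` only;
§0–§2 and the functional `g` are repeated verbatim from `ChargeIdealLaw.lean` so that this file elaborates on a farm snapshot without it).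

WHAT IS PROVED (pen → kernel; no `decide` on designs, no `native_decide`, no axiom ∕ sorry ∕ instance ∕ notation):

* `radial h D : ℤ` — the RADIAL functional `Σ_N m ∏_f (h + a(ℓ_f)) − Σ_P m ∏_f (h + a(ℓ_f))` (a signed cell count weighted by `∏ (2h − colevel_f)`;
  CLASS-LEVEL: `16·radial h D = Σ_{w ∈ {1,h}⁴} (2h)^{#1(w)}·2^{#h(w)}·T(D)(w)` (`sixteen_radial_eq_wordsum`), so under clause 2 of (A1) (tied degrees,
  `t_k` = the common value of the e-free degree-`k` words) `radial h D = Σ_k C(4,k)·h^{4−k}·t_k`; `t_0 = rank`).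
* **LAW 2** `charge_radial_law (h : ℤ) (D : Design) : D.OnAlphabet h → A1e D → 32 ∣ D.mu.re − 2·radial h D ∧ 32 ∣ D.mu.im − 2·radial h D`,
  i.e. `μ ≡ 2(1+i)·R (mod 32)`.  Corollaries: `re_sub_im` (`32 ∣ Re μ − Im μ`, a second proof of LAW 1's third clause given its first two);
  with LAW 1's `16 ∣ Re μ` as a hypothesis: `eight_dvd_radial` (`8 ∣ R`) and `mu_mem32_iff` (`32 ∣ Re μ ∧ 32 ∣ Im μ ↔ 16 ∣ R`) — THE NEW BIT:
  the class of `μ` in `16(1+i)ℤ[i] ∕ 32ℤ[i] ≅ ℤ∕2` equals `R∕8 mod 2`.  In words: a design whose radial functional is `≡ 0 (mod 16)` — e.g. every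
  RADIALLY TRIVIAL design (`T(w) = 0` on all `{1,h}`-words: rank 0 and `t_1 = … = t_4 = 0`, such as pure charge gadgets) — has `μ ∈ 32ℤ[i]`
  (`|μ|_∞ ≥ 32` if charged); the minimal charges `±16(1+i)·i^k` REQUIRE an odd radial bit (`R ≡ 8 mod 16`), hence nonzero `{1,h}`-words.
  Numerically (monad-1 g14 `code/law2.py`, exact stdlib): `W` (188 copies, μ = 448 − 224i = 32(14 − 7i)): R = 2 458 624 = 16·153 664 ✓;
  `G` of `ChargeIdealSharp.lean` (μ = −16 + 16i): R = 896 888 = 8·112 111, odd bit ✓; `K` (μ = 32i): R = 0 ✓; `V`, `A1r8` ✓.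

PROOF.  As in LAW 1, for a weight table `L : Fin 4 → Sym → ℤ[i]`, `Σ_w λ_w T(w) = Σ_N m ∏_f G_f(ℓ_f) − Σ_P m ∏_f G_f(ℓ_f)` (`expand`).  Functionals:
`g = 2h·[1] + 2·[h] + (1+i)[e] + (1−i)[ē]` (reads `2(h + a + x + y) ∈ 4ℤ` on the height-`h` alphabet), `g~ = 2h·[1] + 2·[h] + (1−i)[e] + (1+i)[ē]`
(reads `2(h + a + x − y) ∈ 4ℤ`) and their common e-free truncation `gᵉ = 2h·[1] + 2·[h]` (reads `2(h + a)`).  Tables `L4 = (g,g,g,g)`, `L5 = (g,g,g,g~)`,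
`LE = (gᵉ,gᵉ,gᵉ,gᵉ)`.  CELL side: every `L4`∕`L5` cell term is divisible by `4⁴ = 256`; the `LE` cell term is EXACTLY `16·∏(h + a_f)`, so
`Σ_w λ^E_w T(w) = 16·R` (`expand_LE`).  WORD side: `λ^{L4}_w = λ^{L5}_w = λ^E_w` on e-free words and `λ^E_w = 0` on mixed words, so by clause 1
(`collapseF` applied to `λ^L − λ^E`) `Σ_w λ^L_w T(w) = λ^L(eeee)·μ + λ^L(ēēēē)·μ' + 16R` with `λ^{L4} = (1+i)⁴ = −4 ∕ (1−i)⁴ = −4` and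
`λ^{L5} = (1+i)³(1−i) = 4i ∕ (1−i)³(1+i) = −4i` (`μ' = T(ēēēē)`; `μ' = conj μ` is NOT used).  Hence `256 ∣ −4μ − 4μ' + 16R` and `256 ∣ 4iμ − 4iμ' + 16R`;
real and imaginary parts: `Re μ + Re μ' ≡ 4R`, `Re μ ≡ Re μ'`, `Im μ ≡ −Im μ'`, `−Im μ + Im μ' ≡ −4R (mod 64)` ⇒ `Re μ ≡ Im μ ≡ 2R (mod 32)` (`omega`).  ∎
-/

set_option linter.dupNamespace false
set_option autoImplicit false

namespace Summit.HodgeConjecture.HodgeConjecture.Cruxes.BlochSeedDiscOne.ChargeRadialLaw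

open Summit.HodgeConjecture.HodgeConjecture.Cruxes.BlochSeedDiscOne.DepthBoundA4
/-! ## §0 Clause 1 of (A1) -/

/-- CLAUSE 1 of the tree's `Design.A1`: every e-mixed word other than `eeee` ∕ `ēēēē` has tensor coefficient `0`. -/
def A1e (D : Design) : Prop :=
  ∀ w : Word, ¬ w.efree → w ≠ Word.eeee → w ≠ Word.EEEE → D.T w = 0

theorem a1e_of_a1 (D : Design) (h : D.A1) : A1e D := h.1

/-! ## §1 Weight tables and the multilinear expansion -/

/-- A weight table: one Gaussian weight per (factor, symbol). -/
abbrev Tab := Fin 4 → Sym → GaussianInt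

/-- Word weight `λ_w = ∏_f L f (w f)`. -/
def lamW (L : Tab) (w : Word) : GaussianInt := ∏ f : Fin 4, L f (w f)

/-- Letter functional `G_f(ℓ) = Σ_s L f s · coef s ℓ`. -/
def G (L : Tab) (f : Fin 4) (ℓ : Letter) : GaussianInt := ∑ s : Sym, L f s * s.coef ℓ

/-- Per-cell expansion: `Σ_w λ_w · cellCoef c w = ∏_f G_f(c_f)`. -/
theorem cell_expand (L : Tab) (c : Cell) :
    ∑ w : Word, lamW L w * cellCoef c w = ∏ f : Fin 4, G L f (c f) := by
  unfold G
  rw [Finset.prod_univ_sum, Fintype.piFinset_univ]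
  refine Finset.sum_congr rfl fun w _ => ?_
  unfold lamW cellCoef
  rw [← Finset.prod_mul_distrib]

/-- Weighted list sum `Σ m · φ(cell)`. -/
def wsum (Lst : List (Cell × ℕ)) (φ : Cell → GaussianInt) : GaussianInt :=
  (Lst.map fun cm => (cm.2 : GaussianInt) * φ cm.1).sum

theorem wsum_nil (φ : Cell → GaussianInt) : wsum [] φ = 0 := by simp [wsum]

theorem wsum_cons (a : Cell × ℕ) (t : List (Cell × ℕ)) (φ : Cell → GaussianInt) :
    wsum (a :: t) φ = (a.2 : GaussianInt) * φ a.1 + wsum t φ := by simp [wsum]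

theorem T_eq_wsum (D : Design) (w : Word) :
    D.T w = wsum D.N (fun c => cellCoef c w) - wsum D.P (fun c => cellCoef c w) := rfl

theorem sum_mul_wsum (Lst : List (Cell × ℕ)) (a : Word → GaussianInt) (φ : Word → Cell → GaussianInt) :
    ∑ w : Word, a w * wsum Lst (φ w) = wsum Lst (fun c => ∑ w : Word, a w * φ w c) := by
  induction Lst with
  | nil => simp [wsum_nil]
  | cons hd tl ih =>
    simp only [wsum_cons, mul_add, Finset.sum_add_distrib, ih, Finset.mul_sum]
    congr 1
    exact Finset.sum_congr rfl fun w _ => by ring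

/-- THE EXPANSION: `Σ_w λ_w T(D)(w) = Σ_N m ∏_f G_f − Σ_P m ∏_f G_f`. -/
theorem expand (L : Tab) (D : Design) :
    ∑ w : Word, lamW L w * D.T w
      = wsum D.N (fun c => ∏ f : Fin 4, G L f (c f)) - wsum D.P (fun c => ∏ f : Fin 4, G L f (c f)) := by
  simp only [T_eq_wsum, mul_sub, Finset.sum_sub_distrib]
  rw [sum_mul_wsum, sum_mul_wsum]
  simp only [cell_expand]

/-! ## §2 Collapse of the word side under clause 1 -/

/-- A table kills the e-free words. -/
def KillsEfree (L : Tab) : Prop := ∀ w : Word, w.efree → lamW L w = 0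

theorem eeee_ne_EEEE : Word.eeee ≠ Word.EEEE := by decide

theorem collapse (L : Tab) (D : Design) (hK : KillsEfree L) (hA : A1e D) :
    ∑ w : Word, lamW L w * D.T w
      = lamW L Word.eeee * D.T Word.eeee + lamW L Word.EEEE * D.T Word.EEEE := by
  have key : ∀ w : Word, lamW L w * D.T w =
      (if w = Word.eeee then lamW L Word.eeee * D.T Word.eeee else 0) +
      (if w = Word.EEEE then lamW L Word.EEEE * D.T Word.EEEE else 0) := by
    intro w
    by_cases h1 : w = Word.eeee
    · subst h1
      simp [eeee_ne_EEEE]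
    by_cases h2 : w = Word.EEEE
    · subst h2
      simp [eeee_ne_EEEE.symm]
    by_cases he : w.efree
    · simp [h1, h2, hK w he]
    · simp [h1, h2, hA w he h1 h2]
  rw [Finset.sum_congr rfl fun w _ => key w, Finset.sum_add_distrib, Finset.sum_ite_eq', Finset.sum_ite_eq']
  simp

/-- Collapse for an arbitrary word weight `Λ` vanishing on e-free words (clause 1 kills the rest except `eeee` ∕ `ēēēē`). -/
theorem collapseF (Λ : Word → GaussianInt) (D : Design) (hK : ∀ w : Word, w.efree → Λ w = 0) (hA : A1e D) :
    ∑ w : Word, Λ w * D.T w = Λ Word.eeee * D.T Word.eeee + Λ Word.EEEE * D.T Word.EEEE := by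
  have key : ∀ w : Word, Λ w * D.T w =
      (if w = Word.eeee then Λ Word.eeee * D.T Word.eeee else 0) +
      (if w = Word.EEEE then Λ Word.EEEE * D.T Word.EEEE else 0) := by
    intro w
    by_cases h1 : w = Word.eeee
    · subst h1
      simp [eeee_ne_EEEE]
    by_cases h2 : w = Word.EEEE
    · subst h2
      simp [eeee_ne_EEEE.symm]
    by_cases he : w.efree
    · simp [h1, h2, hK w he]
    · simp [h1, h2, hA w he h1 h2]
  rw [Finset.sum_congr rfl fun w _ => key w, Finset.sum_add_distrib, Finset.sum_ite_eq', Finset.sum_ite_eq']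
  simp

/-! ## §3 The letter functionals `g`, `g~`, `gᵉ` -/

/-- `g`: `one ↦ 2h`, `h ↦ 2`, `e ↦ 1+i`, `ē ↦ 1−i`, `pt ↦ 0` — reads `2(h + a + x + y)`. -/
def tg (h : ℤ) : Sym → GaussianInt
  | Sym.one => 2 * (h : GaussianInt)
  | Sym.h => 2
  | Sym.e => ⟨1, 1⟩
  | Sym.ebar => ⟨1, -1⟩
  | Sym.pt => 0

/-- `g~`: `one ↦ 2h`, `h ↦ 2`, `e ↦ 1−i`, `ē ↦ 1+i`, `pt ↦ 0` — reads `2(h + a + x − y)`. -/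
def tg' (h : ℤ) : Sym → GaussianInt
  | Sym.one => 2 * (h : GaussianInt)
  | Sym.h => 2
  | Sym.e => ⟨1, -1⟩
  | Sym.ebar => ⟨1, 1⟩
  | Sym.pt => 0

/-- `gᵉ`: the common e-free truncation `one ↦ 2h`, `h ↦ 2`, else `0` — reads `2(h + a)`. -/
def te (h : ℤ) : Sym → GaussianInt
  | Sym.one => 2 * (h : GaussianInt)
  | Sym.h => 2
  | Sym.e => 0
  | Sym.ebar => 0
  | Sym.pt => 0

theorem univ_sym : (Finset.univ : Finset Sym) = {Sym.one, Sym.h, Sym.e, Sym.ebar, Sym.pt} := by decide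

theorem sum_sym (φ : Sym → GaussianInt) :
    ∑ s : Sym, φ s = φ Sym.one + φ Sym.h + φ Sym.e + φ Sym.ebar + φ Sym.pt := by
  rw [univ_sym, Finset.sum_insert (by decide), Finset.sum_insert (by decide), Finset.sum_insert (by decide),
    Finset.sum_insert (by decide), Finset.sum_singleton]
  ring

theorem read_tg (h : ℤ) (ℓ : Letter) :
    ∑ s : Sym, tg h s * s.coef ℓ = ((2 * (h + ℓ.a + ℓ.x + ℓ.y) : ℤ) : GaussianInt) := by
  rw [sum_sym]
  ext <;> simp [tg, Sym.coef, Letter.beta, Zsqrtd.re_mul, Zsqrtd.im_mul] <;> ring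

/-- Parity on the height-`h` alphabet: `h + a + x + y` is even. -/
theorem even_of_onAlphabet {h : ℤ} {ℓ : Letter} (hℓ : ℓ.OnAlphabet h) : (2 : ℤ) ∣ h + ℓ.a + ℓ.x + ℓ.y := by
  obtain ⟨hh, _⟩ := hℓ
  unfold Letter.height at hh
  rcases abs_cases ℓ.x with ⟨hx, _⟩ | ⟨hx, _⟩ <;> rcases abs_cases ℓ.y with ⟨hy, _⟩ | ⟨hy, _⟩ <;>
    · rw [hx, hy] at hh; omega

theorem four_dvd_tg {h : ℤ} {ℓ : Letter} (hℓ : ℓ.OnAlphabet h) :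
    ((4 : ℤ) : GaussianInt) ∣ ∑ s : Sym, tg h s * s.coef ℓ := by
  rw [read_tg]
  obtain ⟨k, hk⟩ := even_of_onAlphabet hℓ
  exact ⟨(k : GaussianInt), by rw [hk]; push_cast; ring⟩

theorem read_tg' (h : ℤ) (ℓ : Letter) :
    ∑ s : Sym, tg' h s * s.coef ℓ = ((2 * (h + ℓ.a + ℓ.x - ℓ.y) : ℤ) : GaussianInt) := by
  rw [sum_sym]
  ext <;> simp [tg', Sym.coef, Letter.beta, Zsqrtd.re_mul, Zsqrtd.im_mul] <;> ring

theorem read_te (h : ℤ) (ℓ : Letter) :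
    ∑ s : Sym, te h s * s.coef ℓ = ((2 * (h + ℓ.a) : ℤ) : GaussianInt) := by
  rw [sum_sym]
  ext
  · simp [te, Sym.coef, Zsqrtd.re_mul]; ring
  · simp [te, Sym.coef, Zsqrtd.im_mul]

theorem four_dvd_tg' {h : ℤ} {ℓ : Letter} (hℓ : ℓ.OnAlphabet h) :
    ((4 : ℤ) : GaussianInt) ∣ ∑ s : Sym, tg' h s * s.coef ℓ := by
  rw [read_tg']
  obtain ⟨k, hk⟩ := even_of_onAlphabet hℓ
  have e : h + ℓ.a + ℓ.x - ℓ.y = 2 * (k - ℓ.y) := by omega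
  rw [e]
  exact ⟨((k - ℓ.y : ℤ) : GaussianInt), by push_cast; ring⟩

theorem tg_te (h : ℤ) (s : Sym) (hs : s.efree = true) : tg h s = te h s := by
  cases s <;> simp [Sym.efree] at hs <;> rfl

theorem tg'_te (h : ℤ) (s : Sym) (hs : s.efree = true) : tg' h s = te h s := by
  cases s <;> simp [Sym.efree] at hs <;> rfl

theorem te_of_not_efree (h : ℤ) (s : Sym) (hs : ¬ (s.efree = true)) : te h s = 0 := by
  cases s <;> simp [Sym.efree] at hs <;> rfl

/-! ## §4 The tables `L4 = (g,g,g,g)`, `L5 = (g,g,g,g~)`, `LE = (gᵉ,gᵉ,gᵉ,gᵉ)` -/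

/-- `(g, g, g, g)`. -/
def L4 (h : ℤ) : Tab := fun _ => tg h
/-- `(g, g, g, g~)`. -/
def L5 (h : ℤ) : Tab := fun f => if f = 3 then tg' h else tg h
/-- `(gᵉ, gᵉ, gᵉ, gᵉ)`. -/
def LE (h : ℤ) : Tab := fun _ => te h

theorem lamW_L4_eeee (h : ℤ) : lamW (L4 h) Word.eeee = ⟨-4, 0⟩ := by
  rw [lamW, Fin.prod_univ_four]
  ext <;> simp [L4, tg, Word.eeee, Zsqrtd.re_mul, Zsqrtd.im_mul]
theorem lamW_L4_EEEE (h : ℤ) : lamW (L4 h) Word.EEEE = ⟨-4, 0⟩ := by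
  rw [lamW, Fin.prod_univ_four]
  ext <;> simp [L4, tg, Word.EEEE, Zsqrtd.re_mul, Zsqrtd.im_mul]
theorem lamW_L5_eeee (h : ℤ) : lamW (L5 h) Word.eeee = ⟨0, 4⟩ := by
  ext <;> simp [lamW, Fin.prod_univ_four, L5, tg, tg', Word.eeee, Zsqrtd.re_mul, Zsqrtd.im_mul]
theorem lamW_L5_EEEE (h : ℤ) : lamW (L5 h) Word.EEEE = ⟨0, -4⟩ := by
  ext <;> simp [lamW, Fin.prod_univ_four, L5, tg, tg', Word.EEEE, Zsqrtd.re_mul, Zsqrtd.im_mul]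

/-- tables agreeing with `gᵉ` on e-free symbols have the `LE` weights on e-free words. -/
theorem lamW_agree (L : Tab) (h : ℤ) (hL : ∀ (f : Fin 4) (s : Sym), s.efree = true → L f s = te h s)
    (w : Word) (hw : w.efree) : lamW L w = lamW (LE h) w := by
  unfold lamW LE
  exact Finset.prod_congr rfl fun f _ => hL f (w f) (hw f)

theorem agree_L4 (h : ℤ) : ∀ (f : Fin 4) (s : Sym), s.efree = true → L4 h f s = te h s :=
  fun _ s hs => tg_te h s hs

theorem agree_L5 (h : ℤ) : ∀ (f : Fin 4) (s : Sym), s.efree = true → L5 h f s = te h s := by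
  intro f s hs
  unfold L5
  split
  · exact tg'_te h s hs
  · exact tg_te h s hs

/-- `LE` kills every e-mixed word. -/
theorem lamW_LE_mixed (h : ℤ) (w : Word) (hw : ¬ w.efree) : lamW (LE h) w = 0 := by
  unfold Word.efree at hw
  rw [not_forall] at hw
  obtain ⟨f, hf⟩ := hw
  unfold lamW LE
  exact Finset.prod_eq_zero (Finset.mem_univ f) (te_of_not_efree h (w f) hf)

theorem eeee_mixed : ¬ Word.eeee.efree := fun hw => by
  have h0 := hw 0
  simp [Word.eeee, Sym.efree] at h0

theorem EEEE_mixed : ¬ Word.EEEE.efree := fun hw => by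
  have h0 := hw 0
  simp [Word.EEEE, Sym.efree] at h0

/-- SPLIT of the word side: Bloch words + the e-free part carried by `LE`. -/
theorem split (L : Tab) (h : ℤ) (D : Design) (hL : ∀ (f : Fin 4) (s : Sym), s.efree = true → L f s = te h s)
    (hA : A1e D) :
    ∑ w : Word, lamW L w * D.T w
      = lamW L Word.eeee * D.T Word.eeee + lamW L Word.EEEE * D.T Word.EEEE
        + ∑ w : Word, lamW (LE h) w * D.T w := by
  have hK : ∀ w : Word, w.efree → lamW L w - lamW (LE h) w = 0 :=
    fun w hw => by rw [lamW_agree L h hL w hw, sub_self]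
  have H := collapseF (fun w => lamW L w - lamW (LE h) w) D hK hA
  simp only [sub_mul, Finset.sum_sub_distrib, lamW_LE_mixed h Word.eeee eeee_mixed,
    lamW_LE_mixed h Word.EEEE EEEE_mixed, sub_zero] at H
  rw [sub_eq_iff_eq_add] at H
  rw [H]

/-! ## §5 The radial functional and the exact `LE` expansion -/

/-- integer weighted list sum. -/
def wsumZ (Lst : List (Cell × ℕ)) (ψ : Cell → ℤ) : ℤ := (Lst.map fun cm => (cm.2 : ℤ) * ψ cm.1).sum

theorem wsumZ_nil (ψ : Cell → ℤ) : wsumZ [] ψ = 0 := by simp [wsumZ]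

theorem wsumZ_cons (a : Cell × ℕ) (t : List (Cell × ℕ)) (ψ : Cell → ℤ) :
    wsumZ (a :: t) ψ = (a.2 : ℤ) * ψ a.1 + wsumZ t ψ := by simp [wsumZ]

/-- radial weight of a cell `∏_f (h + a_f)` (`= ∏_f (2h − colevel_f)` on the height-`h` alphabet). -/
def radialCell (h : ℤ) (c : Cell) : ℤ := ∏ f : Fin 4, (h + (c f).a)

/-- **the RADIAL functional** `R_h(D) = Σ_N m ∏_f (h + a_f) − Σ_P m ∏_f (h + a_f)`. -/
def radial (h : ℤ) (D : Design) : ℤ := wsumZ D.N (radialCell h) - wsumZ D.P (radialCell h)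

theorem G_LE (h : ℤ) (f : Fin 4) (ℓ : Letter) : G (LE h) f ℓ = ((2 * (h + ℓ.a) : ℤ) : GaussianInt) := by
  unfold G LE
  exact read_te h ℓ

theorem prod_G_LE (h : ℤ) (c : Cell) :
    ∏ f : Fin 4, G (LE h) f (c f) = ((16 * radialCell h c : ℤ) : GaussianInt) := by
  simp only [G_LE, radialCell]
  rw [Fin.prod_univ_four, Fin.prod_univ_four]
  push_cast
  ring

theorem wsum_sixteen (Lst : List (Cell × ℕ)) (ψ : Cell → ℤ) :
    wsum Lst (fun c => ((16 * ψ c : ℤ) : GaussianInt)) = ((16 * wsumZ Lst ψ : ℤ) : GaussianInt) := by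
  induction Lst with
  | nil => simp [wsum_nil, wsumZ_nil]
  | cons hd tl ih =>
    rw [wsum_cons, wsumZ_cons, ih]
    push_cast
    ring

/-- the `LE` expansion is EXACT: `Σ_w λ^E_w T(w) = 16·R_h(D)`. -/
theorem expand_LE (h : ℤ) (D : Design) :
    ∑ w : Word, lamW (LE h) w * D.T w = ((16 * radial h D : ℤ) : GaussianInt) := by
  rw [expand]
  rw [show (fun c : Cell => ∏ f : Fin 4, G (LE h) f (c f)) = (fun c => ((16 * radialCell h c : ℤ) : GaussianInt)) from
    funext fun c => prod_G_LE h c]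
  rw [wsum_sixteen, wsum_sixteen]
  unfold radial
  push_cast
  ring

/-- class-level reading of the radial functional: `16·R = Σ_w λ^E_w T(w)`, `λ^E_w = (2h)^{#1}·2^{#h}` on `{1,h}`-words, `0` elsewhere. -/
theorem sixteen_radial_eq_wordsum (h : ℤ) (D : Design) :
    ((16 * radial h D : ℤ) : GaussianInt) = ∑ w : Word, lamW (LE h) w * D.T w := (expand_LE h D).symm

/-! ## §6 Divisibility of the cell side (`4⁴ = 256`) -/
theorem dvd_wsum (d : GaussianInt) (Lst : List (Cell × ℕ)) (φ : Cell → GaussianInt)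
    (hφ : ∀ cm ∈ Lst, 0 < cm.2 → d ∣ φ cm.1) : d ∣ wsum Lst φ := by
  unfold wsum
  apply List.dvd_sum
  intro x hx
  obtain ⟨cm, hcm, rfl⟩ := List.mem_map.mp hx
  rcases Nat.eq_zero_or_pos cm.2 with h0 | hpos
  · simp [h0]
  · exact Dvd.dvd.mul_left (hφ cm hcm hpos) _

/-- letters of positive-multiplicity N-entries are on the alphabet. -/
theorem onAlpha_N {h : ℤ} {D : Design} (hD : D.OnAlphabet h) {cm : Cell × ℕ} (hcm : cm ∈ D.N) (hpos : 0 < cm.2)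
    (f : Fin 4) : (cm.1 f).OnAlphabet h :=
  hD cm.1 (List.mem_append.mpr (Or.inl ((mem_suppN_iff D cm.1).mpr ⟨cm.2, hcm, hpos⟩))) f

theorem onAlpha_P {h : ℤ} {D : Design} (hD : D.OnAlphabet h) {cm : Cell × ℕ} (hcm : cm ∈ D.P) (hpos : 0 < cm.2)
    (f : Fin 4) : (cm.1 f).OnAlphabet h :=
  hD cm.1 (List.mem_append.mpr (Or.inr ((mem_suppP_iff D cm.1).mpr ⟨cm.2, hcm, hpos⟩))) f

theorem prod_G (L : Tab) (c : Cell) :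
    ∏ f : Fin 4, G L f (c f) = G L 0 (c 0) * G L 1 (c 1) * G L 2 (c 2) * G L 3 (c 3) := by
  rw [Fin.prod_univ_four]

theorem e256 : ((256 : ℤ) : GaussianInt)
    = ((4 : ℤ) : GaussianInt) * ((4 : ℤ) : GaussianInt) * ((4 : ℤ) : GaussianInt) * ((4 : ℤ) : GaussianInt) := by
  push_cast; norm_num

theorem cell_dvd_L4 {h : ℤ} (c : Cell) (hc : ∀ f : Fin 4, (c f).OnAlphabet h) :
    ((256 : ℤ) : GaussianInt) ∣ ∏ f : Fin 4, G (L4 h) f (c f) := by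
  rw [prod_G, e256]
  refine mul_dvd_mul (mul_dvd_mul (mul_dvd_mul ?_ ?_) ?_) ?_
  · simpa [G, L4] using four_dvd_tg (hc 0)
  · simpa [G, L4] using four_dvd_tg (hc 1)
  · simpa [G, L4] using four_dvd_tg (hc 2)
  · simpa [G, L4] using four_dvd_tg (hc 3)

theorem cell_dvd_L5 {h : ℤ} (c : Cell) (hc : ∀ f : Fin 4, (c f).OnAlphabet h) :
    ((256 : ℤ) : GaussianInt) ∣ ∏ f : Fin 4, G (L5 h) f (c f) := by
  rw [prod_G, e256]
  refine mul_dvd_mul (mul_dvd_mul (mul_dvd_mul ?_ ?_) ?_) ?_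
  · simpa [G, L5] using four_dvd_tg (hc 0)
  · simpa [G, L5] using four_dvd_tg (hc 1)
  · simpa [G, L5] using four_dvd_tg (hc 2)
  · simpa [G, L5] using four_dvd_tg' (hc 3)

/-- the design-level divisibility of `Σ_w λ_w T(w)` for a table whose cell products are all divisible by `d`. -/
theorem design_dvd {h : ℤ} (L : Tab) (d : GaussianInt) (D : Design) (hD : D.OnAlphabet h)
    (hcell : ∀ c : Cell, (∀ f : Fin 4, (c f).OnAlphabet h) → d ∣ ∏ f : Fin 4, G L f (c f)) :
    d ∣ ∑ w : Word, lamW L w * D.T w := by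
  rw [expand]
  refine dvd_sub ?_ ?_
  · exact dvd_wsum d D.N _ fun cm hcm hpos => hcell cm.1 (onAlpha_N hD hcm hpos)
  · exact dvd_wsum d D.P _ fun cm hcm hpos => hcell cm.1 (onAlpha_P hD hcm hpos)

/-! ## §7 THE LAW -/

/-- **CHARGE–RADIAL LAW.**  On any height-`h` alphabet, clause 1 of (A1) forces `Re μ ≡ Im μ ≡ 2·R_h(D) (mod 32)`. -/
theorem charge_radial_law (h : ℤ) (D : Design) (hD : D.OnAlphabet h) (hA : A1e D) :
    (32 : ℤ) ∣ D.mu.re - 2 * radial h D ∧ (32 : ℤ) ∣ D.mu.im - 2 * radial h D := by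
  have h4 := design_dvd (L4 h) _ D hD (fun c hc => cell_dvd_L4 c hc)
  have h5 := design_dvd (L5 h) _ D hD (fun c hc => cell_dvd_L5 c hc)
  rw [split (L4 h) h D (agree_L4 h) hA, lamW_L4_eeee, lamW_L4_EEEE, expand_LE] at h4
  rw [split (L5 h) h D (agree_L5 h) hA, lamW_L5_eeee, lamW_L5_EEEE, expand_LE] at h5
  rw [Zsqrtd.intCast_dvd] at h4 h5
  obtain ⟨h4r, h4i⟩ := h4
  obtain ⟨h5r, h5i⟩ := h5
  simp only [Zsqrtd.re_add, Zsqrtd.im_add, Zsqrtd.re_mul, Zsqrtd.im_mul, Zsqrtd.re_intCast, Zsqrtd.im_intCast]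
    at h4r h4i h5r h5i
  unfold Design.mu
  omega

/-- The same law from the tree's full (A1). -/
theorem charge_radial_law_of_A1 (h : ℤ) (D : Design) (hD : D.OnAlphabet h) (hA : D.A1) :
    (32 : ℤ) ∣ D.mu.re - 2 * radial h D ∧ (32 : ℤ) ∣ D.mu.im - 2 * radial h D :=
  charge_radial_law h D hD (a1e_of_a1 D hA)

/-- Corollary (LAW 2 alone): `Re μ ≡ Im μ (mod 32)` — LAW 1's third clause given its first two, by a second route. -/
theorem re_sub_im (h : ℤ) (D : Design) (hD : D.OnAlphabet h) (hA : A1e D) :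
    (32 : ℤ) ∣ D.mu.re - D.mu.im := by
  obtain ⟨hr, hi⟩ := charge_radial_law h D hD hA
  omega

/-- With LAW 1's `16 ∣ Re μ` (`ChargeIdealLaw.charge_ideal_law`) the radial functional is `≡ 0 (mod 8)`. -/
theorem eight_dvd_radial (h : ℤ) (D : Design) (hD : D.OnAlphabet h) (hA : A1e D) (h16 : (16 : ℤ) ∣ D.mu.re) :
    (8 : ℤ) ∣ radial h D := by
  obtain ⟨hr, -⟩ := charge_radial_law h D hD hA
  omega

/-- THE NEW BIT: `μ ∈ 32ℤ[i]` iff the radial functional is `≡ 0 (mod 16)`; in particular every RADIALLY TRIVIAL clause-1 design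
(`16 ∣ R`, e.g. `T = 0` on all `{1,h}`-words) has `μ ∈ 32ℤ[i]`, and the minimal charges `±16(1+i)·iᵏ` need `R ≡ 8 (mod 16)`. -/
theorem mu_mem32_iff (h : ℤ) (D : Design) (hD : D.OnAlphabet h) (hA : A1e D) :
    ((32 : ℤ) ∣ D.mu.re ∧ (32 : ℤ) ∣ D.mu.im) ↔ (16 : ℤ) ∣ radial h D := by
  obtain ⟨hr, hi⟩ := charge_radial_law h D hD hA
  constructor
  · rintro ⟨h1, -⟩
    omega
  · intro hR
    constructor <;> omega

/-- Radially trivial ⇒ `|μ|_∞ ≥ 32` when charged. -/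
theorem thirtytwo_le_of_charged (h : ℤ) (D : Design) (hD : D.OnAlphabet h) (hA : A1e D)
    (hR : (16 : ℤ) ∣ radial h D) (hμ : D.mu ≠ 0) : 32 ≤ |D.mu.re| ∨ 32 ≤ |D.mu.im| := by
  obtain ⟨hre, him⟩ := (mu_mem32_iff h D hD hA).mpr hR
  by_contra hcon
  push Not at hcon
  obtain ⟨h1, h2⟩ := hcon
  apply hμ
  have hr : D.mu.re = 0 := by
    obtain ⟨r, hr⟩ := hre
    rcases abs_cases D.mu.re with ⟨ha, _⟩ | ⟨ha, _⟩ <;> · rw [ha] at h1; omega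
  have hi : D.mu.im = 0 := by
    obtain ⟨s, hs⟩ := him
    rcases abs_cases D.mu.im with ⟨ha, _⟩ | ⟨ha, _⟩ <;> · rw [ha] at h2; omega
  ext <;> simp [hr, hi]

end Summit.HodgeConjecture.HodgeConjecture.Cruxes.BlochSeedDiscOne.ChargeRadialLaw
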